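import Summits.QuantumFields.YangMills.Theorems.BalabanUVNodesK0RecordFormatNamesFluctC

/-!
# K0⁷ — EDITION 15d: THE CANONICAL (1.4) `Z^{(k)}` — CRIT-1 g34's Z-NORMALISATION RULING (nodeO STATUS 02:19:22Z, «Gram form over the existing `recordCop`, NO `N_on`» 02:42:19Z) on
# porter PT-A-1's located point `Z-NORMALISATION-v1.md` + kernel `…PortS1ZkBasis` ∕ `…PortS1ZkCoarea` (p802912 ∕ p803640): `CoarseIdx ∕ recordLQtMat ∕ recordJacQ ∕ recordGramC ∕ recordZkCan ∕
# recordLogZkCan ∕ recordZkkCan ∕ recordLogZkkCan ∕ recordZkΔ1Can ∕ recordLogZkΔ1Can`, and the `b₀`-BLOCK of `LQ̃` with its displayed LETTER `RecordB0BlockInvertible` (print's «h is uniquely defined»)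

DEFINER seat `ym-nodeO-def-1` (gen 34); `--kind definition --supports stmt-QuantumFields-20541 --as helper`; count-neutral.  [I] = [Balaban1987RG1].

THE POINT (PT-A-1, upheld by CRIT-1).  Print's (1.4) `Z^{(j)}(U_k) = ∫dB δ(Q̃B) exp[−½⟨B, Δ^{(j)}(U_k)B⟩]` is CANONICAL: the δ-function is normalised against Lebesgue measure on the coarse-bond
values of `Q̃B`; by the coarea formula, for ANY basis `C` of `ker LQ̃` (columns), `Z^{(k)} = (√det(LQ̃ LQ̃ᵀ))⁻¹ · √det(CᵀC) · Z14 S C` — basis-free by `BalabanUVNodesPortS1.sqrt_gram_mul_Z14_basis_change`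
(`√det((CA)ᵀ(CA))·Z14 S (CA) = √det(CᵀC)·Z14 S C`), equal to print's graph ∕ `b₀`-elimination form `|det LQ̃|_{b₀}|⁻¹ · Z14 S C_graph` by `…zCan_eq_zLoc` under the letter «the `b₀`-block of
`LQ̃` is invertible» (p.267 «h is uniquely defined»).  ed.15∕15b∕15c's `recordZk ∕ recordZkΔ1 ∕ recordZkk(₁)` = `Z14 S recordCop` ALONE are ARBITRARY-BASIS VARIANTS (fixed up to
`|det A(Vk)|⁻¹`, a factor depending on WHICH basis `Module.finBasis` returned for THAT kernel) — consumed by nothing of record; the SPLIT (27930's closing road) keys `Φ₁` on `recordLogZkCan`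
(or PT-A's `…Loc` under the letter).  PT-A-1 §5: the Jacobian `√det(LQ̃(V^{(k)}) LQ̃(V^{(k)})ᵀ)` IS background-dependent in general (adjoint transports along the averaging paths) — a
genuine, coarse-bond-local factor of `Z^{(k)}`, hence NAMED here (`recordJacQ`).
COORDINATES (OURS, SAID): fine variables in the `su2Gen` coordinates `FluctIdx = (k-bonds) × Fin 3` (ed.15); coarse-bond values of `Q̃` in the `su2Coord` coordinates
`CoarseIdx = ((k+1)-bonds) × Fin 3` — the δ-function's Lebesgue normalisation is taken in these (a background-INDEPENDENT convention factor per coarse bond, cancelling in the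
(1.3)∕(2.12) bracket `log Z^{(k)}(U_{k+1}) − log Z^{(k)}(1)`).

WHAT THIS FILE IS (definitions only): §1 `CoarseIdx`, `recordLQtMat` (the real matrix of `LQ̃`), `recordJacQ := √det(LQ̃ LQ̃ᵀ)`, `recordGramC := √det(CᵀC)` for `C = recordCop`; §2 the
canonical Gaussians `recordZkCan` (over ed.15's [13]-split `recordS … U`), `recordZkkCan` (over ed.15c's corrected (2.11) `recordSk₁`, representative-free), `recordZkΔ1Can` (over
ed.15b's `recordSΔ1 … 𝒞`) and their logarithms; §3 the `b₀`-block `recordLQtB0` of `LQ̃` (rows: coarse coordinates; columns: the coordinates on the central bonds `b₀(c)`) and the LETTER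
`RecordB0BlockInvertible` (hypothesis form; print's «LQ̃h = I has a unique local solution»).  PT-A's graph-coordinate twin `recordZkLoc` (ρZ-2, under the letter, `Matrix.inv` road) is a
CONSUMER-road object (CRIT-1 J2: «a definition of record must not live under `Matrix.inv` junk; a consumer road may») — not defined here; the bridge is `…PortS1ZkCoarea.zCan_eq_zLoc`.

HONEST FRAMING.  Definitions only; NOTHING of Bałaban is asserted, ported or discharged (not the invertibility of the `b₀`-block, not positivity of `CᵀSC`, not the SPLIT); 27930⁸ OPEN;
K0⁷∕K-Ax OPEN; NODE O 0∕1; COUNT 8∕28 · K 1∕4 UNMOVED; finite `𝕋⁴_{L^K}` at fixed ε — NOT continuum ∕ ℝ⁴ ∕ OS; **the Yang–Mills mass gap (Clay) is NOT proved by any of this.**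
No `sorry`, `instance`, `notation`; standard axioms.
-/

noncomputable section

open scoped BigOperators Matrix.Norms.L2Operator

namespace Summit.QuantumFields.YangMills.Theorems.K0RecordFormatNames

open Literature.MathematicalPhysics.QuantumFieldTheory.Balaban1983to89
open Literature.MathematicalPhysics.QuantumFieldTheory.Balaban1983to89.Node00
open Literature.MathematicalPhysics.QuantumFieldTheory.Balaban1983to89.T4Continuum (T4Family)
open _root_.Matrix

variable (F : T4Family)

/-! ## §1  The real matrix of `LQ̃`, the coarea Jacobian, the Gram factor -/

/-- **Real coordinates of the coarse-bond values of `Q̃`**: `(k+1)`-bonds of `T_K` × 𝔰𝔲(2)-colour (`su2Coord`) — the variables of (1.4)'s δ-function. [cite: Balaban1987RG1, (1.4) p.260, p.267] -/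
abbrev CoarseIdx (k K : ℕ) : Type := PBond (F.P K) (k + 1) × Fin 3

/-- **The real matrix of `LQ̃(V^{(k)})`**: entry `((c, j), i)` = the `j`-th 𝔰𝔲(2)-coordinate at the coarse bond `c` of `LQ̃` applied to the `i`-th coordinate vector of `B′`.
[cite: Balaban1987RG1, p.267 («L is a linear transformation»)] -/
def recordLQtMat (k K : ℕ) (Vk : GaugeField (F.P K) k (SU 2)) : Matrix (CoarseIdx F k K) (FluctIdx F k K) ℝ :=
  fun cj i => su2Coord (recordLQt F k K Vk (Pi.single i 1) cj.1) cj.2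

open Classical in
/-- **THE COAREA JACOBIAN `√det(LQ̃ LQ̃ᵀ)`** of (1.4)'s δ-function at the background `V^{(k)}` — background-DEPENDENT in general (PT-A-1 `Z-NORMALISATION-v1.md` §5), hence named.
[cite: Balaban1987RG1, (1.4) p.260, p.268] -/
def recordJacQ (k K : ℕ) (Vk : GaugeField (F.P K) k (SU 2)) : ℝ :=
  Real.sqrt (recordLQtMat F k K Vk * (recordLQtMat F k K Vk)ᵀ).det

/-- **THE GRAM FACTOR `√det(CᵀC)`** of the kernel basis `C = recordCop` (surface measure on `ker LQ̃` vs Lebesgue in the `C`-coordinates). [cite: Balaban1987RG1, (1.4) p.260, p.268 («B′ = CB»)] -/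
def recordGramC (k K : ℕ) (Vk : GaugeField (F.P K) k (SU 2)) : ℝ :=
  Real.sqrt ((recordCop F k K Vk)ᵀ * recordCop F k K Vk).det

/-! ## §2  The canonical (1.4) Gaussians and their logarithms -/

/-- ★ **`Z^{(k)}(U)` CANONICAL — `recordZkCan`**: `(√det(LQ̃LQ̃ᵀ))⁻¹ · √det(CᵀC) · Z14 S C` with `S = recordS … U` (ed.15's [13]-split form at the fine background `U`) and `C = recordCop`
— (1.4) at the background `V^{(k)}`, δ-function w.r.t. Lebesgue on the coarse-bond values, coarea form; basis-free (`…PortS1ZkCoarea.sqrt_gram_mul_Z14_basis_change`).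
[cite: Balaban1987RG1, (1.4) p.260, (1.5) p.261, p.268] -/
def recordZkCan (k K : ℕ) (εbg : ℝ) (U : GaugeField (F.P K) 0 (SU 2)) (Vk : GaugeField (F.P K) k (SU 2))
    (hopLin : (PBond (F.P K) (k + 1) → MatA 2) →ₗ[ℝ] (FluctIdx F k K → ℝ)) : ℝ :=
  (recordJacQ F k K Vk)⁻¹ * recordGramC F k K Vk * B12Eq15QuadraticForm.Z14 (recordS F k K εbg U Vk hopLin) (recordCop F k K Vk)

/-- **`log Z^{(k)}(U)` CANONICAL** — the object the SPLIT's `Φ₁ = log Z^{(k)}(U_{k+1}(W_B)) − log Z^{(k)}(1)` keys on. [cite: Balaban1987RG1, (1.3)–(1.4) p.260, (2.12) p.267] -/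
def recordLogZkCan (k K : ℕ) (εbg : ℝ) (U : GaugeField (F.P K) 0 (SU 2)) (Vk : GaugeField (F.P K) k (SU 2))
    (hopLin : (PBond (F.P K) (k + 1) → MatA 2) →ₗ[ℝ] (FluctIdx F k K → ℝ)) : ℝ :=
  Real.log (recordZkCan F k K εbg U Vk hopLin)

/-- ★ **`Z^{(k)}` CANONICAL over the corrected (2.11) `Δ^{(k)}` (`recordSk₁`, representative-free)** — `(√det(LQ̃LQ̃ᵀ))⁻¹ · √det(CᵀC) · Z14 Sk₁ C`.
[cite: Balaban1987RG1, (1.4) p.260, (2.10)–(2.11) p.267, p.268] -/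
def recordZkkCan (k K : ℕ) (εbg : ℝ) (Vk : GaugeField (F.P K) k (SU 2)) (hopLin : (PBond (F.P K) (k + 1) → MatA 2) →ₗ[ℝ] (FluctIdx F k K → ℝ)) : ℝ :=
  (recordJacQ F k K Vk)⁻¹ * recordGramC F k K Vk * B12Eq15QuadraticForm.Z14 (recordSk₁ F k K εbg Vk hopLin) (recordCop F k K Vk)

/-- **`log Z^{(k)}` CANONICAL over the corrected (2.11) `Δ^{(k)}`.** [cite: Balaban1987RG1, (1.3)–(1.4) p.260, (2.11)–(2.12) p.267] -/
def recordLogZkkCan (k K : ℕ) (εbg : ℝ) (Vk : GaugeField (F.P K) k (SU 2)) (hopLin : (PBond (F.P K) (k + 1) → MatA 2) →ₗ[ℝ] (FluctIdx F k K → ℝ)) : ℝ :=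
  Real.log (recordZkkCan F k K εbg Vk hopLin)

/-- **`Z^{(k)}` CANONICAL over ed.15b's `Δ₁`-form `recordSΔ1 … 𝒞`** (the [13]-split with the displayed `𝒞`). [cite: Balaban1987RG1, (1.4)–(1.5) pp.260–261] -/
def recordZkΔ1Can (k K : ℕ) (εbg : ℝ) (U : GaugeField (F.P K) 0 (SU 2)) (Vk : GaugeField (F.P K) k (SU 2))
    (𝒞 : (FineIdx F K → ℝ) →ₗ[ℝ] (FineIdx F K → ℝ) →ₗ[ℝ] ℝ) (hopLin : (PBond (F.P K) (k + 1) → MatA 2) →ₗ[ℝ] (FluctIdx F k K → ℝ)) : ℝ :=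
  (recordJacQ F k K Vk)⁻¹ * recordGramC F k K Vk * B12Eq15QuadraticForm.Z14 (recordSΔ1 F k K εbg U Vk 𝒞 hopLin) (recordCop F k K Vk)

/-- **`log Z^{(k)}` CANONICAL over the `Δ₁`-form.** [cite: Balaban1987RG1, (1.3)–(1.5) pp.260–261] -/
def recordLogZkΔ1Can (k K : ℕ) (εbg : ℝ) (U : GaugeField (F.P K) 0 (SU 2)) (Vk : GaugeField (F.P K) k (SU 2))
    (𝒞 : (FineIdx F K → ℝ) →ₗ[ℝ] (FineIdx F K → ℝ) →ₗ[ℝ] ℝ) (hopLin : (PBond (F.P K) (k + 1) → MatA 2) →ₗ[ℝ] (FluctIdx F k K → ℝ)) : ℝ :=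
  Real.log (recordZkΔ1Can F k K εbg U Vk 𝒞 hopLin)

/-! ## §3  The `b₀`-block of `LQ̃` and its letter -/

/-- **THE `b₀`-BLOCK `A₁` of `LQ̃(V^{(k)})`**: the square matrix of `LQ̃` restricted to the coordinates on the central bonds `b₀(c)` (rows `(c, j)`, columns `(c′, j′) ↦ (b₀(c′), j′)`) —
print's «the operator `L` restricted to the variables on the bonds `b₀`», whose invertibility makes `h` (LQ̃h = I) unique and local. [cite: Balaban1987RG1, p.267–268] -/
def recordLQtB0 (k K : ℕ) (Vk : GaugeField (F.P K) k (SU 2)) : Matrix (CoarseIdx F k K) (CoarseIdx F k K) ℝ :=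
  fun cj c'j' => recordLQtMat F k K Vk cj (recordB0 F k K c'j'.1, c'j'.2)

open Classical in
/-- **LETTER `RecordB0BlockInvertible F k K Vk`** (hypothesis form; print's «h is uniquely defined», p.267): the `b₀`-block of `LQ̃(V^{(k)})` is invertible — the displayed letter under which
PT-A's graph-coordinate (ρZ-2) road and `…PortS1ZkCoarea.zCan_eq_zLoc` apply.  Asserted for nothing. [cite: Balaban1987RG1, p.267–268] -/
def RecordB0BlockInvertible (k K : ℕ) (Vk : GaugeField (F.P K) k (SU 2)) : Prop :=
  IsUnit (recordLQtB0 F k K Vk).det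

end Summit.QuantumFields.YangMills.Theorems.K0RecordFormatNames

end
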